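import Literature.MathematicalPhysics.KineticTheory.LangevinChainHormander
import Mathlib.Analysis.SpecialFunctions.Integrals.Basic
import Mathlib.RingTheory.Noetherian.Basic
import HarnessLib

/-!
# Linearised observability of the Langevin chain: the costate equation

Trunk T-KINETIC (Literature/MathematicalPhysics/KineticTheory). Support file for the provefact unit
of `CuneoEckmannHairerReyBellet2018_pinnedChain` (second seat: absolute continuity of the transition
probabilities of the Langevin-driven chain WITHOUT Hörmander's theorem, by a finite-dimensional
"partial Malliavin" argument). This file contains the deterministic, linear-algebraic heart of
that argument: the LINEARISED dynamics of the chain along an arbitrary trajectory is observable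
through the momentum of the left bath site. Everything is PROVED; no named facts.

Let `Y` be the drift of the chain (`OscillatorChain.drift`, `LangevinChainHormander.lean`), `ζ` a
continuous curve in phase space and `A(s) = DY(ζ(s))`. A variational solution along `ζ` with
momentum forcing `h` is a solution of `w(τ) = (0, h(τ)) + ∫₀^τ A(s) w(s) ds`; a COSTATE is a
solution of `ċ(s) = G(ζ(s)) c(s)` where `G(x)` (`OscillatorChain.coDrift`) is minus the transpose
of `DY(x)` for the pairing `⟨c, v⟩ = ∑ c.1 i v.1 i + ∑ c.2 i v.2 i` (`dualPair`;
`dualPair_coDrift`: `⟨G(x)c, v⟩ = -⟨c, DY(x)v⟩`).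

* `OscillatorChain.costate_eq_zero_of_snd_left` — **linearised observability**: if the coupling
  is non-degenerate (`V'' ≠ 0`) and the left-bath momentum component `β_0` of a costate vanishes
  on an open set of times, the costate vanishes there (`β_0 ≡ 0 ⇒ α_0 ≡ 0 ⇒ β_1 V''(q_1-q_0) ≡ 0
  ⇒ β_1 ≡ 0 ⇒ …`, using the tridiagonal Hessian `hessPotential_succ`,
  `hessPotential_eq_zero_of_le`). This is the linear shadow of CEHR Prop. 4.1 (Hörmander's
  bracket condition for the chain).
* `OscillatorChain.dualPair_costate_one` — **costate representation of the endpoint**: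
  `⟨c(1), w(1)⟩ = ⟨c(1), φ(1)⟩ + ∫₀¹ ⟨c(s), A(s)φ(s)⟩ ds` for `w = φ + ∫₀ A w`;
  `dualPair_costate_one_momentum`: for `φ = (0, h)`,
  `⟨c(1), w(1)⟩ = ∑ β_i(1) h_i(1) - ∫₀¹ ∑ β̇_i h_i`;
  `dualPair_costate_one_tent`: for the dyadic tent forcing `h = a θ^m_k e_{i₀}`
  (`rtent m k`, slope `2^m` on `[k/2^m, (k+1)/2^m]`),
  **`⟨c(1), w(1)⟩ = a 2^m ∫_{t_k}^{t_{k+1}} β_{i₀}(s) ds`** (`integral_deriv_mul_rtent`, an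
  integration by parts done with the fundamental theorem of calculus).
* `eqOn_zero_of_dyadic_integral_eq_zero` — a continuous function on `[0,1]` all of whose dyadic
  means vanish is zero.
* `OscillatorChain.costate_one_eq_zero_of_dyadic` — **main statement**: a costate whose left-bath
  momentum component has zero mean over every dyadic subinterval of `[0,1]` has `c(1) = 0`.

Consequence drawn in the kernel-density file: along every Brownian trajectory, the derivative of
the time-`1` solution map with respect to the dyadic skeleton of the noise of level `m` is onto
phase space for all large `m` (if a nonzero `c(1)` annihilated its range for all `m`, the tent
directions would give vanishing dyadic means of `β_0`).

## References

* N. Cuneo, J.-P. Eckmann, M. Hairer, L. Rey-Bellet, *Non-equilibrium steady states for networks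
  of oscillators*, EJP 23 (2018) no. 55, Prop. 4.1 (the bracket computation this linearises).
* J.-M. Bismut, *Martingales, the Malliavin calculus and hypoellipticity under general Hörmander's
  conditions*, Z. Wahrsch. 56 (1981) (the costate/controllability point of view). [folklore]

## Design choices

* Linear functionals on phase space are represented by phase-space vectors through `dualPair`
  (phase space carries the sup norm, not an inner product); `exists_dualPair_eq_zero_of_ne_top`
  supplies annihilators of proper subspaces.
* Costates are hypotheses: `c` continuous on `[0,1]` with `ċ = G(ζ)c` on `(0,1)` (the consumer
  constructs them by solving a linear Volterra equation); no ODE existence theory is used here.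
* Dyadic nodes/tents are real-variable (`rnode`, `rtent`); the consumer identifies them with the
  `ℝ≥0`-time tent coefficients of `Literature/Probability/Process/BrownianSkeleton.lean`.
-/

noncomputable section

open MeasureTheory Filter Topology Set Function Finset
open scoped ContDiff NNReal BigOperators

namespace Literature.MathematicalPhysics.KineticTheory.HeatConduction

variable {N : ℕ}

/-! ### The dual pairing on phase space -/

/-- The standard pairing `⟨c, v⟩ = ∑_i c.1 i v.1 i + ∑_i c.2 i v.2 i` on phase space (used to
represent linear functionals by phase-space vectors). [folklore] -/
def dualPair (c v : PhaseSpace N) : ℝ := ∑ i, c.1 i * v.1 i + ∑ i, c.2 i * v.2 i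

/-- `⟨c, ·⟩` is additive. [folklore] -/
theorem dualPair_add_right (c v w : PhaseSpace N) :
    dualPair c (v + w) = dualPair c v + dualPair c w := by
  simp only [dualPair, Prod.fst_add, Prod.snd_add, Pi.add_apply, mul_add, sum_add_distrib]
  ring

/-- `⟨c, ·⟩` is homogeneous. [folklore] -/
theorem dualPair_smul_right (c : PhaseSpace N) (r : ℝ) (v : PhaseSpace N) :
    dualPair c (r • v) = r * dualPair c v := by
  simp only [dualPair, Prod.smul_fst, Prod.smul_snd, Pi.smul_apply, smul_eq_mul, mul_add, mul_sum]
  exact congrArg₂ (· + ·) (sum_congr rfl fun i _ => by ring) (sum_congr rfl fun i _ => by ring)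

/-- `⟨·, v⟩` is additive. [folklore] -/
theorem dualPair_add_left (c d v : PhaseSpace N) :
    dualPair (c + d) v = dualPair c v + dualPair d v := by
  simp only [dualPair, Prod.fst_add, Prod.snd_add, Pi.add_apply, add_mul, sum_add_distrib]
  ring

/-- `⟨c, v - w⟩ = ⟨c, v⟩ - ⟨c, w⟩`. [folklore] -/
theorem dualPair_sub_right (c v w : PhaseSpace N) :
    dualPair c (v - w) = dualPair c v - dualPair c w := by
  simp only [dualPair, Prod.fst_sub, Prod.snd_sub, Pi.sub_apply, mul_sub, sum_sub_distrib]
  ring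

/-- Pairing with a momentum vector `(0, p)`. [folklore] -/
theorem dualPair_zero_mk (c : PhaseSpace N) (p : Fin N → ℝ) :
    dualPair c ((0 : Fin N → ℝ), p) = ∑ i, c.2 i * p i := by
  simp [dualPair]

/-- The pairing is non-degenerate: `⟨c, v⟩ = 0` for all `v` forces `c = 0`. [folklore] -/
theorem eq_zero_of_forall_dualPair_eq_zero {c : PhaseSpace N} (h : ∀ v, dualPair c v = 0) : c = 0 := by
  ext i
  · have := h (Pi.single i 1, 0)
    simpa [dualPair, Pi.single_apply] using this
  · have := h (0, Pi.single i 1)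
    simpa [dualPair, Pi.single_apply] using this

/-- `⟨c, ·⟩` as a linear map. [folklore] -/
def dualPairLinear (c : PhaseSpace N) : PhaseSpace N →ₗ[ℝ] ℝ where
  toFun := dualPair c
  map_add' := dualPair_add_right c
  map_smul' := dualPair_smul_right c

/-- Unfolding `dualPairLinear`. [folklore] -/
@[simp] theorem dualPairLinear_apply (c v : PhaseSpace N) : dualPairLinear c v = dualPair c v := rfl

/-- Every linear functional on phase space is `⟨c, ·⟩` for some `c` (the pairing is perfect):
`c = ((ℓ(e_i,0))_i, (ℓ(0,e_i))_i)`. [folklore] -/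
theorem exists_dualPair_eq (ℓ : PhaseSpace N →ₗ[ℝ] ℝ) :
    ∃ c : PhaseSpace N, ∀ v, ℓ v = dualPair c v := by
  refine ⟨(fun i => ℓ (Pi.single i 1, 0), fun i => ℓ (0, Pi.single i 1)), fun v => ?_⟩
  conv_lhs => rw [eq_sum_unitQ_add_sum_unitP v]
  simp only [map_add, map_sum, map_smul, smul_eq_mul, dualPair, unitQ, unitP]
  exact congrArg₂ (· + ·) (sum_congr rfl fun i _ => mul_comm _ _)
    (sum_congr rfl fun i _ => mul_comm _ _)

/-- **Annihilators of proper subspaces**: if a subspace `W` of phase space is not everything,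
some nonzero `c` pairs to zero with all of `W`. [folklore] -/
theorem exists_dualPair_eq_zero_of_ne_top {W : Submodule ℝ (PhaseSpace N)} (hW : W ≠ ⊤) :
    ∃ c : PhaseSpace N, c ≠ 0 ∧ ∀ v ∈ W, dualPair c v = 0 := by
  obtain ⟨ℓ, hℓ, hℓW⟩ := Submodule.exists_le_ker_of_lt_top W (lt_top_iff_ne_top.2 hW)
  obtain ⟨c, hc⟩ := exists_dualPair_eq ℓ
  refine ⟨c, fun h0 => hℓ (LinearMap.ext fun v => ?_), fun v hv => ?_⟩
  · rw [hc, h0]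
    simp [dualPair]
  · rw [← hc]
    exact LinearMap.mem_ker.1 (hℓW hv)

/-! ### Differentiating the pairing along curves -/

/-- Product rule for the pairing of two differentiable curves in phase space. [folklore] -/
theorem hasDerivAt_dualPair {c u : ℝ → PhaseSpace N} {c' u' : PhaseSpace N} {s : ℝ}
    (hc : HasDerivAt c c' s) (hu : HasDerivAt u u' s) :
    HasDerivAt (fun s => dualPair (c s) (u s)) (dualPair c' (u s) + dualPair (c s) u') s := by
  have hc1 : ∀ i, HasDerivAt (fun s => (c s).1 i) (c'.1 i) s := fun i =>
    (hasDerivAt_pi.1 hc.fst) i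
  have hc2 : ∀ i, HasDerivAt (fun s => (c s).2 i) (c'.2 i) s := fun i =>
    (hasDerivAt_pi.1 hc.snd) i
  have hu1 : ∀ i, HasDerivAt (fun s => (u s).1 i) (u'.1 i) s := fun i =>
    (hasDerivAt_pi.1 hu.fst) i
  have hu2 : ∀ i, HasDerivAt (fun s => (u s).2 i) (u'.2 i) s := fun i =>
    (hasDerivAt_pi.1 hu.snd) i
  have h1 : HasDerivAt (fun s => ∑ i, (c s).1 i * (u s).1 i)
      (∑ i, (c'.1 i * (u s).1 i + (c s).1 i * u'.1 i)) s :=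
    HasDerivAt.fun_sum fun i _ => (hc1 i).fun_mul (hu1 i)
  have h2 : HasDerivAt (fun s => ∑ i, (c s).2 i * (u s).2 i)
      (∑ i, (c'.2 i * (u s).2 i + (c s).2 i * u'.2 i)) s :=
    HasDerivAt.fun_sum fun i _ => (hc2 i).fun_mul (hu2 i)
  have heq : dualPair c' (u s) + dualPair (c s) u' =
      (∑ i, (c'.1 i * (u s).1 i + (c s).1 i * u'.1 i)) +
        ∑ i, (c'.2 i * (u s).2 i + (c s).2 i * u'.2 i) := by
    simp only [dualPair, sum_add_distrib]
    ring
  rw [heq]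
  exact h1.add h2

namespace OscillatorChain

variable (P : OscillatorChain)

/-! ### The transposed linearisation (costate field) -/

/-- The **costate field** `G(x) c`: the NEGATIVE TRANSPOSE of the derivative `DY(x)` of the
drift with respect to the pairing `⟨·,·⟩`, explicitly
`(G(x) c).1 j = ∑_i c.2 i ∂²Φ/∂q_i∂q_j(x)` and `(G(x) c).2 i = -c.1 i + γ ([i=0]+[i=N-1]) c.2 i`,
so that `⟨G(x) c, v⟩ = -⟨c, DY(x) v⟩` (`dualPair_coDrift`). The costate of the linearised flow
along a trajectory `ζ` solves `ċ(s) = G(ζ(s)) c(s)`. [folklore] -/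
def coDrift (N : ℕ) (x : PhaseSpace N) (c : PhaseSpace N) : PhaseSpace N :=
  (fun j => ∑ i, c.2 i * P.hessPotential N i j x.1,
    fun i => -c.1 i + P.γ * bathWeight N i * c.2 i)

/-- **Adjoint identity** `⟨G(x) c, v⟩ = -⟨c, DY(x) v⟩`. [folklore] -/
theorem dualPair_coDrift (hU : ContDiff ℝ ∞ P.U) (hV : ContDiff ℝ ∞ P.V) (N : ℕ)
    (x c v : PhaseSpace N) :
    dualPair (P.coDrift N x c) v = -dualPair c (fderiv ℝ (P.drift N) x v) := by
  rw [P.fderiv_drift_apply hU hV N x v]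
  simp only [dualPair, coDrift]
  have h1 : ∑ j, (∑ i, c.2 i * P.hessPotential N i j x.1) * v.1 j =
      ∑ i, c.2 i * ∑ j, P.hessPotential N i j x.1 * v.1 j := by
    simp_rw [sum_mul, mul_sum]
    rw [Finset.sum_comm]
    exact sum_congr rfl fun i _ => sum_congr rfl fun j _ => by ring
  rw [h1]
  simp only [neg_add, sum_neg_distrib, mul_neg, mul_sub, add_mul, neg_mul, sum_add_distrib,
    sum_sub_distrib]
  have h2 : ∑ i, P.γ * bathWeight N i * c.2 i * v.2 i = ∑ i, P.γ * c.2 i * bathWeight N i * v.2 i :=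
    sum_congr rfl fun i _ => by ring
  rw [h2]
  ring

/-- Components of the costate field. [folklore] -/
@[simp] theorem coDrift_fst (N : ℕ) (x c : PhaseSpace N) (j : Fin N) :
    (P.coDrift N x c).1 j = ∑ i, c.2 i * P.hessPotential N i j x.1 := rfl

/-- Components of the costate field. [folklore] -/
@[simp] theorem coDrift_snd (N : ℕ) (x c : PhaseSpace N) (i : Fin N) :
    (P.coDrift N x c).2 i = -c.1 i + P.γ * bathWeight N i * c.2 i := rfl

/-! ### Linearised observability: a costate whose left-bath momentum component vanishes is zero -/

/-- A real function vanishing on an open set has zero derivative there. [folklore] -/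
theorem _root_.Literature.MathematicalPhysics.KineticTheory.HeatConduction.deriv_eq_zero_of_eqOn_zero
    {f : ℝ → ℝ} {f' : ℝ} {J : Set ℝ} (hJ : IsOpen J) (hf : ∀ s ∈ J, f s = 0) {s : ℝ} (hs : s ∈ J)
    (h : HasDerivAt f f' s) : f' = 0 := by
  have h0 : HasDerivAt f 0 s :=
    (hasDerivAt_const s (0 : ℝ)).congr_of_eventuallyEq
      (Filter.eventually_of_mem (hJ.mem_nhds hs) fun t ht => hf t ht)
  exact h.unique h0

variable {P}

/-- Along a costate curve, a momentum component `β_i` vanishing on an open set forces the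
position component `α_i` to vanish there (`β̇_i = -α_i + γ b_i β_i`). [folklore] -/
theorem costate_fst_eq_zero_of_snd {ζ c : ℝ → PhaseSpace N} {J : Set ℝ} (hJ : IsOpen J)
    (hc : ∀ s ∈ J, HasDerivAt c (P.coDrift N (ζ s) (c s)) s) (i : Fin N)
    (h : ∀ s ∈ J, (c s).2 i = 0) : ∀ s ∈ J, (c s).1 i = 0 := by
  intro s hs
  have hd : HasDerivAt (fun s => (c s).2 i) ((P.coDrift N (ζ s) (c s)).2 i) s :=
    (hasDerivAt_pi.1 (hc s hs).snd) i
  have h0 := deriv_eq_zero_of_eqOn_zero hJ h hs hd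
  rw [coDrift_snd, h s hs, mul_zero, add_zero, neg_eq_zero] at h0
  exact h0

/-- **Linearised observability of the chain through its left end.** Let the coupling be
non-degenerate (`V'' ≠ 0` everywhere) and let `c` solve the costate equation
`ċ(s) = G(ζ(s)) c(s)` along any curve `ζ` on an open set `J` of times. If the momentum component
of `c` at the left bath site vanishes on `J`, then `c` vanishes on `J`: `β_0 ≡ 0 ⇒ α_0 ≡ 0`
(`β̇_0 = -α_0 + γβ_0`) `⇒ β_1 V''(q_1 - q_0) ≡ 0` (`α̇_0 = ∑_i β_i ∂²Φ/∂q_i∂q_0`, tridiagonal)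
`⇒ β_1 ≡ 0 ⇒ …` along the chain. This is the linear-algebraic content of Hörmander's bracket
condition for the chain (CEHR Prop. 4.1), in the form needed for the Malliavin-type argument.
[folklore] -/
theorem costate_eq_zero_of_snd_left (hVnd : ∀ r, deriv (deriv P.V) r ≠ 0) (hN : 0 < N)
    {ζ c : ℝ → PhaseSpace N} {J : Set ℝ} (hJ : IsOpen J)
    (hc : ∀ s ∈ J, HasDerivAt c (P.coDrift N (ζ s) (c s)) s)
    (h0 : ∀ s ∈ J, (c s).2 ⟨0, hN⟩ = 0) : ∀ s ∈ J, c s = 0 := by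
  -- induction along the chain
  have key : ∀ k : ℕ, ∀ i : Fin N, i.val ≤ k →
      (∀ s ∈ J, (c s).2 i = 0) ∧ (∀ s ∈ J, (c s).1 i = 0) := by
    intro k
    induction k with
    | zero =>
      intro i hi
      have hi0 : i = ⟨0, hN⟩ := Fin.ext (Nat.le_zero.1 hi)
      subst hi0
      exact ⟨h0, costate_fst_eq_zero_of_snd hJ hc _ h0⟩
    | succ k ih =>
      intro i hi
      by_cases hik : i.val ≤ k
      · exact ih i hik
      have hival : i.val = k + 1 := by omega
      have hkN : k < N := by omega
      set j : Fin N := ⟨k, hkN⟩ with hjdef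
      -- `α_j ≡ 0`, hence its derivative `∑_l β_l hess_{l j}` vanishes on `J`
      have hαj : ∀ s ∈ J, (c s).1 j = 0 := (ih j le_rfl).2
      have hβi : ∀ s ∈ J, (c s).2 i = 0 := by
        intro s hs
        have hd : HasDerivAt (fun s => (c s).1 j) ((P.coDrift N (ζ s) (c s)).1 j) s :=
          (hasDerivAt_pi.1 (hc s hs).fst) j
        have hsum := deriv_eq_zero_of_eqOn_zero hJ hαj hs hd
        rw [coDrift_fst, Finset.sum_eq_single i] at hsum
        · have hij : i.val = j.val + 1 := by simp [hjdef, hival]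
          rw [P.hessPotential_succ N hij] at hsum
          rcases mul_eq_zero.1 hsum with h | h
          · exact h
          · exact absurd (neg_eq_zero.1 h) (hVnd _)
        · intro l _ hli
          by_cases hlk : l.val ≤ k
          · rw [(ih l hlk).1 s hs, zero_mul]
          · have hl2 : j.val + 2 ≤ l.val := by
              have : l.val ≠ k + 1 := fun h => hli (Fin.ext (by omega))
              simp only [hjdef]
              omega
            rw [P.hessPotential_eq_zero_of_le N hl2, mul_zero]
        · simp
      exact ⟨hβi, costate_fst_eq_zero_of_snd hJ hc i hβi⟩
  intro s hs
  ext i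
  · exact (key i.val i le_rfl).2 s hs
  · exact (key i.val i le_rfl).1 s hs

/-! ### The costate representation of the endpoint of a variational solution -/

/-- The pairing is jointly continuous. [folklore] -/
theorem _root_.Literature.MathematicalPhysics.KineticTheory.HeatConduction.continuous_dualPair :
    Continuous fun p : PhaseSpace N × PhaseSpace N => dualPair p.1 p.2 := by
  unfold dualPair
  fun_prop

/-- `s ↦ DY(ζ(s))` is continuous along a continuous curve (smooth potentials). [folklore] -/
theorem continuous_fderiv_drift_comp (hU : ContDiff ℝ ∞ P.U) (hV : ContDiff ℝ ∞ P.V) (N : ℕ)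
    {ζ : ℝ → PhaseSpace N} (hζ : Continuous ζ) :
    Continuous fun s => fderiv ℝ (P.drift N) (ζ s) :=
  ((P.contDiff_drift hU hV N).continuous_fderiv (by simp)).comp hζ

/-- **Costate representation.** Let `w` solve the linearised (variational) integral equation
`w(τ) = φ(τ) + ∫₀^τ DY(ζ(s)) w(s) ds` on `[0, 1]` along a continuous curve `ζ`, and let `c` be a
costate (`ċ = G(ζ) c` on `(0, 1)`, continuous on `[0, 1]`). Then
`⟨c(1), w(1)⟩ = ⟨c(1), φ(1)⟩ + ∫₀¹ ⟨c(s), DY(ζ(s)) φ(s)⟩ ds`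
(differentiate `⟨c, w - φ⟩`; the `⟨c, DY (w-φ)⟩` terms cancel by the adjoint identity).
[folklore] -/
theorem dualPair_costate_one (hU : ContDiff ℝ ∞ P.U) (hV : ContDiff ℝ ∞ P.V)
    {ζ c w φ : ℝ → PhaseSpace N} (hζ : Continuous ζ) (hw : Continuous w) (hφ : Continuous φ)
    (hcc : ContinuousOn c (Icc 0 1))
    (hc : ∀ s ∈ Ioo (0 : ℝ) 1, HasDerivAt c (P.coDrift N (ζ s) (c s)) s)
    (hwint : ∀ τ ∈ Icc (0 : ℝ) 1, w τ = φ τ + ∫ s in (0 : ℝ)..τ, fderiv ℝ (P.drift N) (ζ s) (w s)) :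
    dualPair (c 1) (w 1) =
      dualPair (c 1) (φ 1) + ∫ s in (0 : ℝ)..1, dualPair (c s) (fderiv ℝ (P.drift N) (ζ s) (φ s)) := by
  set A : ℝ → PhaseSpace N →L[ℝ] PhaseSpace N := fun s => fderiv ℝ (P.drift N) (ζ s) with hA
  have hAc : Continuous A := P.continuous_fderiv_drift_comp hU hV N hζ
  have hg : Continuous fun s => A s (w s) := hAc.clm_apply hw
  set u : ℝ → PhaseSpace N := fun τ => ∫ s in (0 : ℝ)..τ, A s (w s) with hu
  have hud : ∀ τ, HasDerivAt u (A τ (w τ)) τ := fun τ => (hg.integral_hasStrictDerivAt 0 τ).hasDerivAt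
  have huc : Continuous u := continuous_iff_continuousAt.2 fun τ => (hud τ).continuousAt
  have hwu : ∀ τ ∈ Icc (0 : ℝ) 1, w τ - u τ = φ τ := fun τ hτ => by
    rw [hwint τ hτ, hu]
    exact add_sub_cancel_right _ _
  -- `F(s) = ⟨c s, u s⟩` has derivative `⟨c s, A s (φ s)⟩` on `(0, 1)`
  set F : ℝ → ℝ := fun s => dualPair (c s) (u s) with hF
  set F' : ℝ → ℝ := fun s => dualPair (c s) (A s (φ s)) with hF'
  have hFd : ∀ s ∈ Ioo (0 : ℝ) 1, HasDerivWithinAt F (F' s) (Ioi s) s := by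
    intro s hs
    have h := hasDerivAt_dualPair (hc s hs) (hud s)
    have hval : dualPair (P.coDrift N (ζ s) (c s)) (u s) + dualPair (c s) (A s (w s)) = F' s := by
      rw [P.dualPair_coDrift hU hV, hF']
      change -dualPair (c s) (A s (u s)) + dualPair (c s) (A s (w s)) = dualPair (c s) (A s (φ s))
      rw [← hwu s (Ioo_subset_Icc_self hs), map_sub, dualPair_sub_right]
      ring
    rw [hval] at h
    exact h.hasDerivWithinAt
  have hFc : ContinuousOn F (Icc 0 1) :=
    continuous_dualPair.comp_continuousOn (hcc.prodMk huc.continuousOn)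
  have hF'c : ContinuousOn F' (Icc 0 1) :=
    continuous_dualPair.comp_continuousOn (hcc.prodMk ((hAc.clm_apply hφ).continuousOn))
  have hint : IntervalIntegrable F' volume 0 1 :=
    (hF'c.mono (by rw [Set.uIcc_of_le zero_le_one])).intervalIntegrable
  have hFTC := intervalIntegral.integral_eq_sub_of_hasDeriv_right_of_le zero_le_one hFc hFd hint
  -- evaluate `F 1` and `F 0`
  have hF0 : F 0 = 0 := by simp [hF, hu, dualPair]
  have hF1 : F 1 = dualPair (c 1) (w 1) - dualPair (c 1) (φ 1) := by
    rw [hF]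
    change dualPair (c 1) (u 1) = _
    rw [← hwu 1 (right_mem_Icc.2 zero_le_one), dualPair_sub_right]
    ring
  rw [hF0, hF1, sub_zero] at hFTC
  linarith

/-- The derivative of the drift on a pure momentum vector: `DY(x)(0, p) = (p, -γ 1_B p)` (no
Hessian term). [folklore] -/
theorem fderiv_drift_apply_zero_mk (hU : ContDiff ℝ ∞ P.U) (hV : ContDiff ℝ ∞ P.V) (N : ℕ)
    (x : PhaseSpace N) (p : Fin N → ℝ) :
    fderiv ℝ (P.drift N) x ((0 : Fin N → ℝ), p) = (p, fun i => -(P.γ * bathWeight N i * p i)) := by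
  rw [P.fderiv_drift_apply hU hV N x]
  ext i <;> simp

/-- `⟨c, DY(x)(0, p)⟩ = -∑_i (G(x) c).2 i p i`. [folklore] -/
theorem dualPair_fderiv_drift_zero_mk (hU : ContDiff ℝ ∞ P.U) (hV : ContDiff ℝ ∞ P.V) (N : ℕ)
    (x c : PhaseSpace N) (p : Fin N → ℝ) :
    dualPair c (fderiv ℝ (P.drift N) x ((0 : Fin N → ℝ), p)) = -∑ i, (P.coDrift N x c).2 i * p i := by
  rw [P.fderiv_drift_apply_zero_mk hU hV N x p]
  simp only [dualPair, coDrift_snd, mul_neg, sum_neg_distrib, neg_add_rev, neg_neg, add_mul,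
    neg_mul, sum_add_distrib]
  have h1 : ∑ i, c.2 i * (P.γ * bathWeight N i * p i) = ∑ i, P.γ * bathWeight N i * c.2 i * p i :=
    sum_congr rfl fun i _ => by ring
  rw [h1]
  ring

/-- **Costate representation for momentum forcing**: if the forcing is a pure momentum path
`φ(s) = (0, h(s))`, then
`⟨c(1), w(1)⟩ = ∑_i β_i(1) h_i(1) - ∫₀¹ ∑_i β̇_i(s) h_i(s) ds`, `β = c.2`, `β̇ = (G(ζ)c).2`.
[folklore] -/
theorem dualPair_costate_one_momentum (hU : ContDiff ℝ ∞ P.U) (hV : ContDiff ℝ ∞ P.V)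
    {ζ c w : ℝ → PhaseSpace N} {h : ℝ → Fin N → ℝ} (hζ : Continuous ζ) (hw : Continuous w)
    (hh : Continuous h) (hcc : ContinuousOn c (Icc 0 1))
    (hc : ∀ s ∈ Ioo (0 : ℝ) 1, HasDerivAt c (P.coDrift N (ζ s) (c s)) s)
    (hwint : ∀ τ ∈ Icc (0 : ℝ) 1,
      w τ = ((0 : Fin N → ℝ), h τ) + ∫ s in (0 : ℝ)..τ, fderiv ℝ (P.drift N) (ζ s) (w s)) :
    dualPair (c 1) (w 1) =
      ∑ i, (c 1).2 i * h 1 i - ∫ s in (0 : ℝ)..1, ∑ i, (P.coDrift N (ζ s) (c s)).2 i * h s i := by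
  have hφ : Continuous fun s => (((0 : Fin N → ℝ), h s) : PhaseSpace N) := continuous_const.prodMk hh
  rw [P.dualPair_costate_one hU hV hζ hw hφ hcc hc hwint, dualPair_zero_mk]
  simp_rw [P.dualPair_fderiv_drift_zero_mk hU hV]
  rw [intervalIntegral.integral_neg, sub_eq_add_neg]

end OscillatorChain

/-! ### Dyadic tents on the line and the integration-by-parts identity -/

/-- The dyadic node `t^m_k = k/2^m` (real). [folklore] -/
def rnode (m k : ℕ) : ℝ := (k : ℝ) / 2 ^ m

/-- The dyadic tent `θ^m_k(s) = 2^m (min(t_{k+1}, s) - min(t_k, s))`: `0` before `t_k`, `1` after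
`t_{k+1}`, slope `2^m` in between. [folklore] -/
def rtent (m k : ℕ) (s : ℝ) : ℝ := 2 ^ m * (min (rnode m (k + 1)) s - min (rnode m k) s)

/-- `t_{k+1} - t_k = 2^{-m}`. [folklore] -/
theorem rnode_succ_sub (m k : ℕ) : rnode m (k + 1) - rnode m k = 1 / 2 ^ m := by
  unfold rnode; push_cast; ring

/-- `t_k ≤ t_{k+1}`. [folklore] -/
theorem rnode_le_succ (m k : ℕ) : rnode m k ≤ rnode m (k + 1) := by
  have := rnode_succ_sub m k
  have h : (0 : ℝ) < 1 / 2 ^ m := by positivity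
  linarith

/-- `0 ≤ t_k`. [folklore] -/
theorem rnode_nonneg (m k : ℕ) : 0 ≤ rnode m k := by unfold rnode; positivity

/-- `0 < t_{k+1}`. [folklore] -/
theorem rnode_succ_pos (m k : ℕ) : 0 < rnode m (k + 1) := by unfold rnode; positivity

/-- `t_{k+1} ≤ 1` for `k < 2^m`. [folklore] -/
theorem rnode_succ_le_one {m k : ℕ} (hk : k < 2 ^ m) : rnode m (k + 1) ≤ 1 := by
  unfold rnode
  rw [div_le_one (by positivity)]
  exact_mod_cast hk

/-- `t_0 = 0`. [folklore] -/
@[simp] theorem rnode_zero (m : ℕ) : rnode m 0 = 0 := by simp [rnode]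

/-- `t_{2^m} = 1`. [folklore] -/
theorem rnode_two_pow (m : ℕ) : rnode m (2 ^ m) = 1 := by
  unfold rnode; push_cast; exact div_self (by positivity)

/-- The tent is continuous. [folklore] -/
@[fun_prop] theorem continuous_rtent (m k : ℕ) : Continuous (rtent m k) := by
  unfold rtent; fun_prop

/-- Before `t_k` the tent vanishes. [folklore] -/
theorem rtent_of_le {m k : ℕ} {s : ℝ} (hs : s ≤ rnode m k) : rtent m k s = 0 := by
  unfold rtent
  rw [min_eq_right hs, min_eq_right (hs.trans (rnode_le_succ m k))]
  ring

/-- After `t_{k+1}` the tent is `1`. [folklore] -/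
theorem rtent_of_ge {m k : ℕ} {s : ℝ} (hs : rnode m (k + 1) ≤ s) : rtent m k s = 1 := by
  unfold rtent
  rw [min_eq_left hs, min_eq_left ((rnode_le_succ m k).trans hs), rnode_succ_sub]
  field_simp

/-- On `[t_k, t_{k+1}]` the tent is affine with slope `2^m`. [folklore] -/
theorem rtent_of_mem {m k : ℕ} {s : ℝ} (hs : s ∈ Icc (rnode m k) (rnode m (k + 1))) :
    rtent m k s = 2 ^ m * (s - rnode m k) := by
  unfold rtent
  rw [min_eq_right hs.2, min_eq_left hs.1]

/-- `θ^m_k(1) = 1` for `k < 2^m`. [folklore] -/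
theorem rtent_one {m k : ℕ} (hk : k < 2 ^ m) : rtent m k 1 = 1 := rtent_of_ge (rnode_succ_le_one hk)

/-- **Integration by parts against a dyadic tent.** For `β` continuous on `[0, 1]` with a
derivative `β'` on `(0, 1)` that extends continuously to `[0, 1]`:
`∫₀¹ β'(s) θ^m_k(s) ds = β(1) - 2^m ∫_{t_k}^{t_{k+1}} β(s) ds`. [folklore] -/
theorem integral_deriv_mul_rtent {β β' : ℝ → ℝ} (hβc : ContinuousOn β (Icc 0 1))
    (hβ'c : ContinuousOn β' (Icc 0 1)) (hβ : ∀ s ∈ Ioo (0 : ℝ) 1, HasDerivAt β (β' s) s) {m k : ℕ}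
    (hk : k < 2 ^ m) :
    ∫ s in (0 : ℝ)..1, β' s * rtent m k s = β 1 - 2 ^ m * ∫ s in rnode m k..rnode m (k + 1), β s := by
  set a := rnode m k with ha
  set b := rnode m (k + 1) with hb
  have ha0 : 0 ≤ a := rnode_nonneg m k
  have hab : a ≤ b := rnode_le_succ m k
  have hb0 : 0 < b := rnode_succ_pos m k
  have hb1 : b ≤ 1 := rnode_succ_le_one hk
  have ha1 : a ≤ 1 := hab.trans hb1
  have hprod : ContinuousOn (fun s => β' s * rtent m k s) (Icc 0 1) :=
    hβ'c.mul (continuous_rtent m k).continuousOn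
  have hii : ∀ x y : ℝ, x ∈ Icc (0 : ℝ) 1 → y ∈ Icc (0 : ℝ) 1 →
      IntervalIntegrable (fun s => β' s * rtent m k s) volume x y := fun x y hx hy =>
    (hprod.mono (uIcc_subset_Icc hx hy)).intervalIntegrable
  have hiiβ : ∀ x y : ℝ, x ∈ Icc (0 : ℝ) 1 → y ∈ Icc (0 : ℝ) 1 →
      IntervalIntegrable β volume x y := fun x y hx hy =>
    (hβc.mono (uIcc_subset_Icc hx hy)).intervalIntegrable
  have hiiβ' : ∀ x y : ℝ, x ∈ Icc (0 : ℝ) 1 → y ∈ Icc (0 : ℝ) 1 →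
      IntervalIntegrable β' volume x y := fun x y hx hy =>
    (hβ'c.mono (uIcc_subset_Icc hx hy)).intervalIntegrable
  have hmem0 : (0 : ℝ) ∈ Icc (0 : ℝ) 1 := ⟨le_rfl, zero_le_one⟩
  have hmem1 : (1 : ℝ) ∈ Icc (0 : ℝ) 1 := ⟨zero_le_one, le_rfl⟩
  have hmema : a ∈ Icc (0 : ℝ) 1 := ⟨ha0, ha1⟩
  have hmemb : b ∈ Icc (0 : ℝ) 1 := ⟨hb0.le, hb1⟩
  -- split the integral at `a` and `b`
  rw [← intervalIntegral.integral_add_adjacent_intervals (hii 0 a hmem0 hmema) (hii a 1 hmema hmem1),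
    ← intervalIntegral.integral_add_adjacent_intervals (hii a b hmema hmemb) (hii b 1 hmemb hmem1)]
  -- `[0, a]`: the tent vanishes
  have h1 : ∫ s in (0 : ℝ)..a, β' s * rtent m k s = 0 := by
    rw [intervalIntegral.integral_congr (g := fun _ => (0 : ℝ)) fun s hs => ?_]
    · simp
    · rw [uIcc_of_le ha0] at hs
      simp [rtent_of_le hs.2]
  -- `[b, 1]`: the tent is `1`
  have h3 : ∫ s in b..(1 : ℝ), β' s * rtent m k s = β 1 - β b := by
    rw [intervalIntegral.integral_congr (g := β') fun s hs => ?_]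
    · refine intervalIntegral.integral_eq_sub_of_hasDeriv_right_of_le hb1 (hβc.mono (Icc_subset_Icc hb0.le le_rfl))
        (fun s hs => (hβ s ⟨hb0.trans hs.1, hs.2⟩).hasDerivWithinAt) (hiiβ' b 1 hmemb hmem1)
    · rw [uIcc_of_le hb1] at hs
      simp [rtent_of_ge hs.1]
  -- `[a, b]`: fundamental theorem for `β(s) 2^m (s - a)`
  have h2 : ∫ s in a..b, β' s * rtent m k s = β b - 2 ^ m * ∫ s in a..b, β s := by
    have hG : ∫ s in a..b, (β' s * (2 ^ m * (s - a)) + β s * 2 ^ m) =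
        β b * (2 ^ m * (b - a)) - β a * (2 ^ m * (a - a)) := by
      have hlinc : Continuous fun s : ℝ => (2 : ℝ) ^ m * (s - a) := by fun_prop
      refine intervalIntegral.integral_eq_sub_of_hasDeriv_right_of_le hab
        ((hβc.mono (Icc_subset_Icc ha0 hb1)).mul hlinc.continuousOn) (fun s hs => ?_) ?_
      · have hs' : s ∈ Ioo (0 : ℝ) 1 := ⟨ha0.trans_lt hs.1, hs.2.trans_le hb1⟩
        have hlin : HasDerivAt (fun s : ℝ => 2 ^ m * (s - a)) (2 ^ m) s := by
          simpa using ((hasDerivAt_id s).sub_const a).const_mul (2 ^ m : ℝ)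
        exact ((hβ s hs').mul hlin).hasDerivWithinAt
      · exact ((hβ'c.mul hlinc.continuousOn).add (hβc.mul continuousOn_const)).mono
          (uIcc_subset_Icc hmema hmemb) |>.intervalIntegrable
    have hlinc : Continuous fun s : ℝ => (2 : ℝ) ^ m * (s - a) := by fun_prop
    have hI1 : IntervalIntegrable (fun s => β' s * (2 ^ m * (s - a))) volume a b :=
      ((hβ'c.mul hlinc.continuousOn).mono (uIcc_subset_Icc hmema hmemb)).intervalIntegrable
    have hI2 : IntervalIntegrable (fun s => β s * 2 ^ m) volume a b :=
      ((hβc.mul continuousOn_const).mono (uIcc_subset_Icc hmema hmemb)).intervalIntegrable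
    have hsplit : ∫ s in a..b, (β' s * (2 ^ m * (s - a)) + β s * 2 ^ m) =
        (∫ s in a..b, β' s * (2 ^ m * (s - a))) + ∫ s in a..b, β s * 2 ^ m :=
      intervalIntegral.integral_add hI1 hI2
    rw [sub_self, mul_zero, mul_zero, sub_zero, show b - a = 1 / 2 ^ m from rnode_succ_sub m k,
      hsplit, intervalIntegral.integral_mul_const] at hG
    have hcongr : ∫ s in a..b, β' s * rtent m k s = ∫ s in a..b, β' s * (2 ^ m * (s - a)) :=
      intervalIntegral.integral_congr fun s hs => by
        rw [uIcc_of_le hab] at hs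
        simp only [rtent_of_mem hs, ha]
    rw [hcongr]
    have h2m : (2 : ℝ) ^ m * (1 / 2 ^ m) = 1 := by field_simp
    rw [h2m, mul_one] at hG
    linarith
  rw [h1, h2, h3]
  ring

/-- **Vanishing dyadic means force a continuous function to vanish.** If `f` is continuous on
`[0, 1]` and `∫_{t_k}^{t_{k+1}} f = 0` for all dyadic intervals of all levels, then `f = 0` on
`[0, 1]` (the primitive vanishes at all dyadic nodes, hence everywhere; differentiate).
[folklore] -/
theorem eqOn_zero_of_dyadic_integral_eq_zero {f : ℝ → ℝ} (hf : ContinuousOn f (Icc 0 1))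
    (h : ∀ m k : ℕ, k < 2 ^ m → ∫ s in rnode m k..rnode m (k + 1), f s = 0) :
    ∀ s ∈ Icc (0 : ℝ) 1, f s = 0 := by
  have hii : ∀ x y : ℝ, x ∈ Icc (0 : ℝ) 1 → y ∈ Icc (0 : ℝ) 1 → IntervalIntegrable f volume x y :=
    fun x y hx hy => (hf.mono (uIcc_subset_Icc hx hy)).intervalIntegrable
  set F : ℝ → ℝ := fun t => ∫ s in (0 : ℝ)..t, f s with hF
  have hFc : ContinuousOn F (Icc 0 1) := by
    have := intervalIntegral.continuousOn_primitive_interval' (hii 0 1 ⟨le_rfl, zero_le_one⟩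
      ⟨zero_le_one, le_rfl⟩) (left_mem_uIcc : (0 : ℝ) ∈ uIcc (0 : ℝ) 1)
    rwa [Set.uIcc_of_le zero_le_one] at this
  -- `F` vanishes at the dyadic nodes
  have hnode_mem : ∀ m k : ℕ, k ≤ 2 ^ m → rnode m k ∈ Icc (0 : ℝ) 1 := fun m k hk =>
    ⟨rnode_nonneg m k, by unfold rnode; rw [div_le_one (by positivity)]; exact_mod_cast hk⟩
  have hFnode : ∀ m k : ℕ, k ≤ 2 ^ m → F (rnode m k) = 0 := by
    intro m k
    induction k with
    | zero => intro _; simp [hF]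
    | succ k ih =>
      intro hk
      have hk' : k < 2 ^ m := Nat.lt_of_succ_le hk
      rw [hF]
      change ∫ s in (0 : ℝ)..rnode m (k + 1), f s = 0
      rw [← intervalIntegral.integral_add_adjacent_intervals
        (hii _ _ ⟨le_rfl, zero_le_one⟩ (hnode_mem m k hk'.le))
        (hii _ _ (hnode_mem m k hk'.le) (hnode_mem m (k + 1) hk)), h m k hk', add_zero]
      exact ih hk'.le
  -- hence everywhere on `[0, 1]`, by continuity and density of the dyadics
  have hFzero : ∀ t ∈ Icc (0 : ℝ) 1, F t = 0 := by
    intro t ht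
    set d : ℕ → ℝ := fun m => rnode m ⌊t * 2 ^ m⌋₊ with hd
    have hdle : ∀ m, ⌊t * 2 ^ m⌋₊ ≤ 2 ^ m := fun m => by
      have h1 : (⌊t * 2 ^ m⌋₊ : ℝ) ≤ t * 2 ^ m := Nat.floor_le (by have := ht.1; positivity)
      have h2 : t * 2 ^ m ≤ 2 ^ m := by nlinarith [ht.2, pow_pos (two_pos : (0 : ℝ) < 2) m]
      exact_mod_cast h1.trans h2
    have hdmem : ∀ m, d m ∈ Icc (0 : ℝ) 1 := fun m => hnode_mem m _ (hdle m)
    have hdist : ∀ m, |t - d m| ≤ (1 / 2 : ℝ) ^ m := by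
      intro m
      have hpos : (0 : ℝ) < 2 ^ m := by positivity
      have h1 : (⌊t * 2 ^ m⌋₊ : ℝ) ≤ t * 2 ^ m := Nat.floor_le (by have := ht.1; positivity)
      have h2 : t * 2 ^ m < ⌊t * 2 ^ m⌋₊ + 1 := Nat.lt_floor_add_one _
      have hdm : d m = (⌊t * 2 ^ m⌋₊ : ℝ) / 2 ^ m := rfl
      have hdm' : t - d m = (t * 2 ^ m - ⌊t * 2 ^ m⌋₊) / 2 ^ m := by
        rw [hdm]; field_simp
      have e1 : 0 ≤ t - d m := by rw [hdm']; exact div_nonneg (by linarith) hpos.le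
      have e2 : t - d m ≤ (1 / 2 : ℝ) ^ m := by
        rw [hdm', one_div_pow]
        exact div_le_div_of_nonneg_right (by linarith) hpos.le
      have e3 : (0 : ℝ) < (1 / 2 : ℝ) ^ m := by positivity
      rw [abs_le]
      exact ⟨by linarith, e2⟩
    have hdt : Tendsto d atTop (𝓝 t) := by
      have h0 : Tendsto (fun m => (1 / 2 : ℝ) ^ m) atTop (𝓝 0) :=
        tendsto_pow_atTop_nhds_zero_of_lt_one (by norm_num) (by norm_num)
      rw [tendsto_iff_norm_sub_tendsto_zero]
      refine squeeze_zero (fun m => norm_nonneg _) (fun m => ?_) h0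
      rw [Real.norm_eq_abs, abs_sub_comm]
      exact hdist m
    have hlim : Tendsto (F ∘ d) atTop (𝓝 (F t)) :=
      (hFc t ht).tendsto.comp (tendsto_nhdsWithin_iff.2 ⟨hdt, Filter.Eventually.of_forall hdmem⟩)
    have hconst : (F ∘ d) = fun _ => 0 := funext fun m => hFnode m _ (hdle m)
    rw [hconst] at hlim
    exact tendsto_nhds_unique hlim tendsto_const_nhds
  -- differentiate on `(0, 1)`
  have hIoo : ∀ t ∈ Ioo (0 : ℝ) 1, f t = 0 := by
    intro t ht
    have hderiv : HasDerivAt F (f t) t :=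
      intervalIntegral.integral_hasDerivAt_right (hii 0 t ⟨le_rfl, zero_le_one⟩ (Ioo_subset_Icc_self ht))
        (ContinuousOn.stronglyMeasurableAtFilter isOpen_Ioo (hf.mono Ioo_subset_Icc_self) t ht)
        ((hf.mono Ioo_subset_Icc_self).continuousAt (isOpen_Ioo.mem_nhds ht))
    exact deriv_eq_zero_of_eqOn_zero isOpen_Ioo (fun s hs => hFzero s (Ioo_subset_Icc_self hs)) ht hderiv
  -- and pass to the closure
  have hEq : EqOn f (fun _ => (0 : ℝ)) (Icc 0 1) :=
    (show EqOn f (fun _ => (0 : ℝ)) (Ioo 0 1) from hIoo).of_subset_closure hf continuousOn_const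
      Ioo_subset_Icc_self (by rw [closure_Ioo zero_ne_one])
  exact hEq

namespace OscillatorChain

variable {P : OscillatorChain}

/-- **Costate representation for a dyadic tent forcing at one momentum coordinate**: if
`w(τ) = (0, a θ^m_k(τ) e_{i₀}) + ∫₀^τ DY(ζ) w`, then
`⟨c(1), w(1)⟩ = a 2^m ∫_{t_k}^{t_{k+1}} β_{i₀}(s) ds`, `β_{i₀} = (c ·).2 i₀`. [folklore] -/
theorem dualPair_costate_one_tent (hU : ContDiff ℝ ∞ P.U) (hV : ContDiff ℝ ∞ P.V)
    {ζ c w : ℝ → PhaseSpace N} (hζ : Continuous ζ) (hw : Continuous w)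
    (hcc : ContinuousOn c (Icc 0 1))
    (hc : ∀ s ∈ Ioo (0 : ℝ) 1, HasDerivAt c (P.coDrift N (ζ s) (c s)) s) (i₀ : Fin N) (a : ℝ)
    {m k : ℕ} (hk : k < 2 ^ m)
    (hwint : ∀ τ ∈ Icc (0 : ℝ) 1,
      w τ = ((0 : Fin N → ℝ), fun i => if i = i₀ then a * rtent m k τ else 0) +
        ∫ s in (0 : ℝ)..τ, fderiv ℝ (P.drift N) (ζ s) (w s)) :
    dualPair (c 1) (w 1) = a * 2 ^ m * ∫ s in rnode m k..rnode m (k + 1), (c s).2 i₀ := by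
  have hh : Continuous fun τ : ℝ => fun i : Fin N => if i = i₀ then a * rtent m k τ else 0 := by
    refine continuous_pi fun i => ?_
    split_ifs <;> fun_prop
  rw [P.dualPair_costate_one_momentum hU hV hζ hw hh hcc hc hwint]
  simp only [mul_ite, mul_zero, Finset.sum_ite_eq', Finset.mem_univ, if_true, rtent_one hk, mul_one]
  -- the integration by parts
  set β : ℝ → ℝ := fun s => (c s).2 i₀ with hβ
  set β' : ℝ → ℝ := fun s => (P.coDrift N (ζ s) (c s)).2 i₀ with hβ'
  have hβc : ContinuousOn β (Icc 0 1) :=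
    ((continuous_apply i₀).comp continuous_snd).comp_continuousOn hcc
  have hβ'c : ContinuousOn β' (Icc 0 1) := by
    have h1 : ContinuousOn (fun s => (c s).1 i₀) (Icc 0 1) :=
      ((continuous_apply i₀).comp continuous_fst).comp_continuousOn hcc
    simp only [hβ', coDrift_snd]
    exact h1.neg.add (continuousOn_const.mul hβc)
  have hβd : ∀ s ∈ Ioo (0 : ℝ) 1, HasDerivAt β (β' s) s := fun s hs =>
    (hasDerivAt_pi.1 (hc s hs).snd) i₀
  have hibp := integral_deriv_mul_rtent hβc hβ'c hβd hk
  have hint : ∫ s in (0 : ℝ)..1, (P.coDrift N (ζ s) (c s)).2 i₀ * (a * rtent m k s) =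
      a * ∫ s in (0 : ℝ)..1, β' s * rtent m k s := by
    rw [← intervalIntegral.integral_const_mul]
    exact intervalIntegral.integral_congr fun s _ => by simp only [hβ']; ring
  rw [hint, hibp]
  simp only [hβ]
  ring

/-- **The main observability statement.** Let the coupling be non-degenerate and let `c` be a
costate along a curve `ζ` on `[0, 1]` (continuous on `[0,1]`, `ċ = G(ζ)c` on `(0,1)`). If the
left-bath momentum component `β_0 = (c ·).2 0` has zero mean over every dyadic subinterval of
`[0, 1]`, then `c(1) = 0`. (Vanishing dyadic means force `β_0 ≡ 0` on `[0,1]`; linearised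
observability forces `c ≡ 0` on `(0,1)`; continuity gives `c(1) = 0`.) [folklore] -/
theorem costate_one_eq_zero_of_dyadic (hVnd : ∀ r, deriv (deriv P.V) r ≠ 0) (hN : 0 < N)
    {ζ c : ℝ → PhaseSpace N} (hcc : ContinuousOn c (Icc 0 1))
    (hc : ∀ s ∈ Ioo (0 : ℝ) 1, HasDerivAt c (P.coDrift N (ζ s) (c s)) s)
    (h : ∀ m k : ℕ, k < 2 ^ m → ∫ s in rnode m k..rnode m (k + 1), (c s).2 ⟨0, hN⟩ = 0) :
    c 1 = 0 := by
  have hβc : ContinuousOn (fun s => (c s).2 ⟨0, hN⟩) (Icc 0 1) :=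
    ((continuous_apply _).comp continuous_snd).comp_continuousOn hcc
  have hβ := eqOn_zero_of_dyadic_integral_eq_zero hβc h
  have hzero : ∀ s ∈ Ioo (0 : ℝ) 1, c s = 0 :=
    costate_eq_zero_of_snd_left hVnd hN isOpen_Ioo hc fun s hs => hβ s (Ioo_subset_Icc_self hs)
  have hEq : EqOn c (fun _ => (0 : PhaseSpace N)) (Icc 0 1) :=
    (show EqOn c (fun _ => (0 : PhaseSpace N)) (Ioo 0 1) from hzero).of_subset_closure hcc
      continuousOn_const Ioo_subset_Icc_self (by rw [closure_Ioo zero_ne_one])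
  exact hEq (right_mem_Icc.2 zero_le_one)

end OscillatorChain

end Literature.MathematicalPhysics.KineticTheory.HeatConduction
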